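import Literature.NumberTheory.LFunctions.RodgersTaoEnergy
import Literature.NumberTheory.LFunctions.DeBruijnHLogDerivSeries
import Literature.NumberTheory.LFunctions.DeBruijnHSimpleZerosProofs
import Literature.NumberTheory.LFunctions.DeBruijnNewmanConstProofs
import HarnessLib

/-!
# Rodgers–Tao 2020, §1.2 and §3: the real zeros `0 < x_1(t) < x_2(t) < ⋯` of `H_t` for `t > Λ`

Trunk T-ANT (`Literature/NumberTheory/LFunctions`). Proofs only (no named facts). Companion of
`RodgersTaoEnergy.lean`, which defines the zero count `N_t(I) = Literature.NumberTheory.LFunctions.deBruijnZeroCount t I`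
and the `j`-th positive zero `x_j(t) = Literature.NumberTheory.LFunctions.deBruijnZero t j` of de Bruijn's `H_t`
(`Literature.NumberTheory.LFunctions.deBruijnH`), and of `RodgersTaoZerosProofs.lean`, which identified the
`x_j(0)` with `2γ_{j−1}` under `Λ < 0`. Here we prove, for **every** time `t` above `Λ` — in the
`sInf`-free form "`H_{t₁}` has only real zeros for some `t₁ < t`" used throughout the Rodgers–Tao
files — the standing description of the zeros in B. Rodgers, T. Tao, *The de Bruijn–Newman
constant is non-negative*, Forum Math. Pi 8 (2020), §1.2:

> "Let `Λ < t ≤ 0`, then the zeroes of `H_t` are all real, and symmetric around the origin. It is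
> a result of Csordas, Smith, and Varga that the zeroes are also distinct and avoid the origin.
> Thus we can express the zeroes of `H_t` as `(x_j(t))_{j ∈ ℤ*}`, `0 < x_1(t) < x_2(t) < …`,
> `x_{−j}(t) = −x_j(t)`."

(the restriction `t ≤ 0` plays no role in this statement). Concretely, for such `t`:

* `Literature.NumberTheory.LFunctions.finite_deBruijnH_zeros_of_isCompact` — the zeros of the entire function `H_t ≢ 0` in a
  compact set are finite (any `t`);
* `Literature.NumberTheory.LFunctions.infinite_setOf_deBruijnH_eq_zero` — `H_t` has infinitely many zeros (any `t`): by the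
  grouped Hadamard product `H_t(z) = H_t(0) ∏ (1 + b_n z²)` of the tree
  (`Literature.NumberTheory.LFunctions.exists_isHadamardSeq`, Polymath 15 §3) finitely many zeros would make `H_t` a
  polynomial, whereas `H_t(iy) = ∫₀^∞ e^{tu²} Φ(u) cosh(yu) du ≥ c · cosh y` (`Φ > 0`);
* `Literature.NumberTheory.LFunctions.infinite_pos_zeros_deBruijnH` — hence, when all zeros are real, infinitely many positive
  real zeros (`H_t` is even and `H_t(0) ≠ 0`);
* `Literature.NumberTheory.LFunctions.deBruijnH_deBruijnZero` , `Literature.NumberTheory.LFunctions.deBruijnZero_pos`,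
  `Literature.NumberTheory.LFunctions.strictMono_deBruijnZero`, `Literature.NumberTheory.LFunctions.deBruijnZeroCount_Icc_deBruijnZero`,
  `Literature.NumberTheory.LFunctions.exists_deBruijnZero_eq` — for `t > Λ`: `x_j(t)` (`j ≥ 1`) is a zero of `H_t`,
  `0 = x_0(t) < x_1(t) < x_2(t) < ⋯`, `N_t([0, x_j(t)]) = j`, and every positive zero is an
  `x_j(t)`; `Literature.NumberTheory.LFunctions.deriv_deBruijnH_deBruijnZero_ne_zero` — these zeros are simple
  (Csordas–Smith–Varga, `Literature.NumberTheory.LFunctions.csordasSmithVarga_simple_zeros_holds`);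
* `Literature.NumberTheory.LFunctions.renormEnergy_nonneg_of_lt`, `Literature.NumberTheory.LFunctions.renormEnergyOn_mono_of_lt` — consequently
  the renormalised energies `Ẽ_{jk}(t) ≥ 0` (`j ≠ k`) and `Ẽ^I(t)` is monotone in `I` (Rodgers–Tao
  2020, §7: "this is clearly a non-negative quantity that is non-decreasing in `I`"), at every
  time `t > Λ` — the form needed by §§7–8 of the source (cf. the `t = 0` versions
  `renormEnergy_zero_nonneg`, `renormEnergyOn_zero_mono` of `RodgersTaoEnergyProofs.lean`).

The order-theoretic part is carried out once and for all for an arbitrary set `S ⊆ ℝ` that avoids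
`0`, is finite in every `[0, X]` and has infinitely many positive elements (namespace
`Literature.NumberTheory.LFunctions.PosEnum`: `count S X = #(S ∩ [0, X])`, `nth S j = inf {X ≥ 0 | j ≤ count S X}`), of which
`N_t([0, X])` and `x_j(t)` are the instance `S = {x | H_t(x) = 0}` (definitionally).

## References

* B. Rodgers, T. Tao, *The de Bruijn–Newman constant is non-negative*, Forum Math. Pi 8 (2020),
  e6 = arXiv:1801.05914, §1.2, §3 (definition of `N_t`), §7.
* G. Csordas, W. Smith, R. S. Varga, *Lehmer pairs of zeros, the de Bruijn–Newman constant `Λ`,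
  and the Riemann Hypothesis*, Constr. Approx. 10 (1994), 107–129, Thm. 2.2.
* D. H. J. Polymath, *Effective approximation of heat flow evolution of the Riemann `ξ` function,
  and a new upper bound for the de Bruijn–Newman constant*, Res. Math. Sci. 6 (2019), §3.
-/

noncomputable section

open Complex Filter Set Topology MeasureTheory

namespace Literature.NumberTheory.LFunctions

/-! ## Enumeration of a locally finite set of positive reals -/

namespace PosEnum

/-- `count S X = #(S ∩ [0, X])` (as `Set.ncard`; junk `0` if infinite). [folklore] -/
def count (S : Set ℝ) (X : ℝ) : ℕ := {x : ℝ | x ∈ Icc 0 X ∧ x ∈ S}.ncard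

/-- `nth S j = inf {X ≥ 0 | j ≤ count S X}`: the `j`-th positive element of `S` (`nth S 0 = 0`).
[folklore] -/
def nth (S : Set ℝ) (j : ℕ) : ℝ := sInf {X : ℝ | 0 ≤ X ∧ j ≤ count S X}

variable {S : Set ℝ}

/-- The defining set of `nth S j` is bounded below by `0`. [folklore] -/
theorem bddBelow_setOf (S : Set ℝ) (j : ℕ) : BddBelow {X : ℝ | 0 ≤ X ∧ j ≤ count S X} :=
  ⟨0, fun _ hX ↦ hX.1⟩

/-- `nth S 0 = 0`. [folklore] -/
@[simp] theorem nth_zero (S : Set ℝ) : nth S 0 = 0 := by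
  rw [nth]
  have : {X : ℝ | 0 ≤ X ∧ 0 ≤ count S X} = Ici 0 := by ext X; simp
  rw [this, csInf_Ici]

/-- `0 ≤ nth S j`. [folklore] -/
theorem nth_nonneg (S : Set ℝ) (j : ℕ) : 0 ≤ nth S j := by
  rw [nth]
  rcases Set.eq_empty_or_nonempty {X : ℝ | 0 ≤ X ∧ j ≤ count S X} with h | h
  · rw [h, Real.sInf_empty]
  · exact le_csInf h fun X hX ↦ hX.1

/-- `count S X = 0` for `X < 0`. [folklore] -/
theorem count_of_neg {X : ℝ} (hX : X < 0) : count S X = 0 := by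
  rw [count]
  have : {x : ℝ | x ∈ Icc 0 X ∧ x ∈ S} = ∅ := by
    ext x
    simp only [mem_setOf_eq, mem_Icc, mem_empty_iff_false, iff_false, not_and]
    intro h; linarith [h.1, h.2]
  rw [this, ncard_empty]

/-- If `0 ∉ S` then `count S 0 = 0`. [folklore] -/
theorem count_zero (h0 : (0 : ℝ) ∉ S) : count S 0 = 0 := by
  rw [count]
  have : {x : ℝ | x ∈ Icc 0 0 ∧ x ∈ S} = ∅ := by
    ext x
    simp only [mem_setOf_eq, Icc_self, mem_singleton_iff, mem_empty_iff_false, iff_false, not_and]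
    rintro rfl; exact h0
  rw [this, ncard_empty]

section Finite

variable (hfin : ∀ X : ℝ, {x : ℝ | x ∈ Icc 0 X ∧ x ∈ S}.Finite)
include hfin

/-- `count S` is monotone. [folklore] -/
theorem count_mono {X Y : ℝ} (h : X ≤ Y) : count S X ≤ count S Y :=
  ncard_le_ncard (fun _ hx ↦ ⟨⟨hx.1.1, hx.1.2.trans h⟩, hx.2⟩) (hfin Y)

/-- Right-continuity of the counting function: `count S (X + δ) = count S X` for some `δ > 0`.
[folklore] -/
theorem exists_count_add_eq (X : ℝ) : ∃ δ : ℝ, 0 < δ ∧ count S (X + δ) = count S X := by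
  set F : Set ℝ := {x : ℝ | x ∈ Icc 0 (X + 1) ∧ x ∈ S} ∩ Ioi X with hF
  have hFf : F.Finite := (hfin (X + 1)).inter_of_left _
  rcases F.eq_empty_or_nonempty with hFe | hFne
  · refine ⟨1, one_pos, congrArg Set.ncard (Set.ext fun x ↦ ⟨fun hx ↦ ⟨⟨hx.1.1, ?_⟩, hx.2⟩,
      fun hx ↦ ⟨⟨hx.1.1, by linarith [hx.1.2]⟩, hx.2⟩⟩)⟩
    by_contra hlt
    have : x ∈ F := ⟨hx, lt_of_not_ge hlt⟩
    rw [hFe] at this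
    exact this
  · obtain ⟨m, hmF, hm⟩ := Set.exists_min_image F id hFf hFne
    have hmX : X < m := hmF.2
    refine ⟨(m - X) / 2, by linarith, congrArg Set.ncard (Set.ext fun x ↦ ⟨fun hx ↦ ?_,
      fun hx ↦ ⟨⟨hx.1.1, by linarith [hx.1.2]⟩, hx.2⟩⟩)⟩
    refine ⟨⟨hx.1.1, ?_⟩, hx.2⟩
    by_contra hlt
    have hxF : x ∈ F := ⟨⟨⟨hx.1.1, by linarith [hx.1.2, hmF.1.1.2]⟩, hx.2⟩, lt_of_not_ge hlt⟩
    have := hm x hxF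
    simp only [id_eq] at this
    linarith [hx.1.2]

/-- If `S` has infinitely many positive elements, every level `j` is reached by `count S`.
[folklore] -/
theorem nonempty_setOf (hinf : {x : ℝ | 0 < x ∧ x ∈ S}.Infinite) (j : ℕ) :
    {X : ℝ | 0 ≤ X ∧ j ≤ count S X}.Nonempty := by
  obtain ⟨F, hFS, hFcard⟩ := hinf.exists_subset_card_eq j
  rcases F.eq_empty_or_nonempty with hFe | hFne
  · refine ⟨0, le_rfl, ?_⟩
    rw [hFe, Finset.card_empty] at hFcard
    omega
  · refine ⟨F.max' hFne, ?_, ?_⟩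
    · exact (hFS (F.max'_mem hFne)).1.le
    · rw [← hFcard, count, ← ncard_coe_finset]
      exact ncard_le_ncard (fun x hx ↦ ⟨⟨(hFS hx).1.le, F.le_max' x hx⟩, (hFS hx).2⟩) (hfin _)

variable (hinf : {x : ℝ | 0 < x ∧ x ∈ S}.Infinite)
include hinf

/-- The infimum defining `nth S j` is attained from the right: `j ≤ count S (nth S j)`.
[folklore] -/
theorem le_count_nth (j : ℕ) : j ≤ count S (nth S j) := by
  obtain ⟨δ, hδ, heq⟩ := exists_count_add_eq hfin (nth S j)
  have hlt : sInf {X : ℝ | 0 ≤ X ∧ j ≤ count S X} < nth S j + δ := by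
    change nth S j < nth S j + δ; linarith
  obtain ⟨X, hX, hXlt⟩ := exists_lt_of_csInf_lt (nonempty_setOf hfin hinf j) hlt
  rw [← heq]
  exact hX.2.trans (count_mono hfin hXlt.le)

/-- `nth S j ≤ X ↔ j ≤ count S X` for `X ≥ 0`. [folklore] -/
theorem nth_le_iff {j : ℕ} {X : ℝ} (hX : 0 ≤ X) : nth S j ≤ X ↔ j ≤ count S X :=
  ⟨fun h ↦ (le_count_nth hfin hinf j).trans (count_mono hfin h),
    fun h ↦ csInf_le (bddBelow_setOf S j) ⟨hX, h⟩⟩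

/-- Below `nth S j` (and above `0`) the count is `< j`. [folklore] -/
theorem count_lt_of_lt_nth {j : ℕ} {X : ℝ} (hX : 0 ≤ X) (h : X < nth S j) : count S X < j := by
  by_contra hle
  exact absurd ((nth_le_iff hfin hinf hX).2 (not_lt.1 hle)) (not_le.2 h)

/-- `nth S` is non-decreasing. [folklore] -/
theorem nth_mono : Monotone (nth S) := fun j k hjk ↦
  csInf_le_csInf (bddBelow_setOf S j) (nonempty_setOf hfin hinf k) fun _ hX ↦ ⟨hX.1, hjk.trans hX.2⟩

/-- For `j ≥ 1`, `nth S j` is an element of `S`. [folklore] -/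
theorem nth_mem {j : ℕ} (hj : 1 ≤ j) : nth S j ∈ S := by
  by_contra hnot
  set X₀ := nth S j with hX₀
  have hX₀0 : 0 ≤ X₀ := nth_nonneg S j
  set F : Set ℝ := {x : ℝ | x ∈ Icc 0 X₀ ∧ x ∈ S} with hF
  have hFf : F.Finite := hfin X₀
  have hlt : ∀ x ∈ F, x < X₀ := fun x hx ↦
    lt_of_le_of_ne hx.1.2 fun h ↦ hnot (h ▸ hx.2)
  rcases F.eq_empty_or_nonempty with hFe | hFne
  · have h1 : count S X₀ = 0 := by rw [count, ← hF, hFe, ncard_empty]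
    have h2 := le_count_nth hfin hinf j
    rw [← hX₀, h1] at h2
    omega
  · obtain ⟨m, hmF, hm⟩ := Set.exists_max_image F id hFf hFne
    simp only [id_eq] at hm
    have hmX₀ : m < X₀ := hlt m hmF
    have hFm : {x : ℝ | x ∈ Icc 0 m ∧ x ∈ S} = F := Set.ext fun x ↦
      ⟨fun hx ↦ ⟨⟨hx.1.1, hx.1.2.trans hmX₀.le⟩, hx.2⟩, fun hx ↦ ⟨⟨hx.1.1, hm x hx⟩, hx.2⟩⟩
    have hcm : count S m = count S X₀ := by rw [count, hFm, count]
    have hjm : j ≤ count S m := hcm ▸ le_count_nth hfin hinf j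
    have : X₀ ≤ m := (nth_le_iff hfin hinf hmF.1.1).2 hjm
    linarith

/-- `nth S j > 0` for `j ≥ 1` (provided `0 ∉ S`). [folklore] -/
theorem nth_pos (h0 : (0 : ℝ) ∉ S) {j : ℕ} (hj : 1 ≤ j) : 0 < nth S j :=
  lt_of_le_of_ne (nth_nonneg S j) fun h ↦ h0 (h ▸ nth_mem hfin hinf hj)

/-- The count at the `j`-th element is exactly `j` (provided `0 ∉ S`). [folklore] -/
theorem count_nth (h0 : (0 : ℝ) ∉ S) (j : ℕ) : count S (nth S j) = j := by
  rcases Nat.eq_zero_or_pos j with rfl | hj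
  · rw [nth_zero, count_zero h0]
  refine le_antisymm ?_ (le_count_nth hfin hinf j)
  set X₀ := nth S j with hX₀
  set F : Set ℝ := {x : ℝ | x ∈ Icc 0 X₀ ∧ x ∈ S} with hF
  have hFf : F.Finite := hfin X₀
  have hX₀F : X₀ ∈ F := ⟨⟨nth_nonneg S j, le_rfl⟩, nth_mem hfin hinf hj⟩
  set F' : Set ℝ := F \ {X₀} with hF'
  have hF'f : F'.Finite := hFf.subset sdiff_subset
  have hlt : ∀ x ∈ F', x < X₀ := fun x hx ↦ lt_of_le_of_ne hx.1.1.2 hx.2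
  have hcard : F'.ncard + 1 = count S X₀ := by
    rw [count, ← hF]; exact ncard_sdiff_singleton_add_one hX₀F hFf
  rcases F'.eq_empty_or_nonempty with hFe | hFne
  · rw [← hcard, hFe, ncard_empty]; omega
  · obtain ⟨m, hmF, hm⟩ := Set.exists_max_image F' id hF'f hFne
    simp only [id_eq] at hm
    have hmX₀ : m < X₀ := hlt m hmF
    have hFm : {x : ℝ | x ∈ Icc 0 m ∧ x ∈ S} = F' := Set.ext fun x ↦
      ⟨fun hx ↦ ⟨⟨⟨hx.1.1, hx.1.2.trans hmX₀.le⟩, hx.2⟩, fun h ↦ by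
        rw [mem_singleton_iff] at h; rw [h] at hx; linarith [hx.1.2]⟩,
        fun hx ↦ ⟨⟨hx.1.1.1, hm x hx⟩, hx.1.2⟩⟩
    have hcm : count S m = F'.ncard := by rw [count, hFm]
    have := count_lt_of_lt_nth hfin hinf hmF.1.1.1 (hX₀ ▸ hmX₀)
    rw [hcm] at this
    omega

/-- `nth S` is strictly increasing (provided `0 ∉ S`). [folklore] -/
theorem nth_strictMono (h0 : (0 : ℝ) ∉ S) : StrictMono (nth S) := by
  refine strictMono_nat_of_lt_succ fun j ↦ lt_of_le_of_ne (nth_mono hfin hinf j.le_succ) fun heq ↦ ?_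
  have h1 := le_count_nth hfin hinf (j + 1)
  rw [← heq, count_nth hfin hinf h0 j] at h1
  omega

/-- Every positive element of `S` is an `nth S j`, namely with `j = count S p ≥ 1`. [folklore] -/
theorem exists_nth_eq (h0 : (0 : ℝ) ∉ S) {p : ℝ} (hp0 : 0 < p) (hp : p ∈ S) :
    ∃ j : ℕ, 1 ≤ j ∧ nth S j = p := by
  set j := count S p with hj
  have hpF : p ∈ {x : ℝ | x ∈ Icc 0 p ∧ x ∈ S} := ⟨⟨hp0.le, le_rfl⟩, hp⟩
  have hj1 : 1 ≤ j := by
    rw [hj, count, Nat.one_le_iff_ne_zero, Ne, ncard_eq_zero (hfin p)]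
    exact fun h ↦ by rw [h] at hpF; exact hpF
  refine ⟨j, hj1, ?_⟩
  have hle : nth S j ≤ p := (nth_le_iff hfin hinf hp0.le).2 le_rfl
  refine le_antisymm hle ?_
  by_contra hlt
  push Not at hlt
  -- the points of `S` in `[0, nth S j]` together with `p` lie in `[0, p]`
  have hsub : insert p {x : ℝ | x ∈ Icc 0 (nth S j) ∧ x ∈ S} ⊆ {x : ℝ | x ∈ Icc 0 p ∧ x ∈ S} := by
    rintro x (rfl | hx)
    · exact hpF
    · exact ⟨⟨hx.1.1, hx.1.2.trans hle⟩, hx.2⟩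
  have hnot : p ∉ {x : ℝ | x ∈ Icc 0 (nth S j) ∧ x ∈ S} := fun h ↦ by linarith [h.1.2]
  have h1 := ncard_le_ncard hsub (hfin p)
  rw [ncard_insert_of_notMem hnot (hfin _)] at h1
  have h2 : count S (nth S j) + 1 ≤ count S p := h1
  rw [count_nth hfin hinf h0 j] at h2
  omega

/-- Between consecutive elements the count is constant: if `nth S j ≤ X < nth S (j+1)` then
`count S X = j`. [folklore] -/
theorem count_eq_of_nth_le_of_lt {j : ℕ} {X : ℝ} (h1 : nth S j ≤ X)
    (h2 : X < nth S (j + 1)) : count S X = j := by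
  have hX : 0 ≤ X := (nth_nonneg S j).trans h1
  refine le_antisymm ?_ ((nth_le_iff hfin hinf hX).1 h1)
  have := count_lt_of_lt_nth hfin hinf hX h2
  omega

end Finite

end PosEnum

/-! ## The zeros of `H_t`: finiteness on compacts, infinitude -/

/-- The zeros of `H_t` in a compact set form a finite set: `H_t` is entire
(`differentiable_deBruijnH_holds`) and not identically zero (`H_t(0) ≠ 0`), so an accumulation
point of zeros is excluded by the identity theorem. [folklore] -/
theorem finite_deBruijnH_zeros_of_isCompact (t : ℝ) {K : Set ℂ} (hK : IsCompact K) :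
    {z : ℂ | z ∈ K ∧ deBruijnH t z = 0}.Finite := by
  by_contra hinf
  obtain ⟨z, -, hz⟩ := Set.Infinite.exists_accPt_of_subset_isCompact hinf hK fun z hz ↦ hz.1
  have hfreq : ∃ᶠ w in 𝓝[≠] z, deBruijnH t w = 0 :=
    (accPt_iff_frequently_nhdsNE.mp hz).mono fun w hw ↦ hw.2
  have han : AnalyticOnNhd ℂ (deBruijnH t) univ :=
    (differentiable_deBruijnH_holds t).differentiableOn.analyticOnNhd isOpen_univ
  have h0 := han.eqOn_zero_of_preconnected_of_frequently_eq_zero isPreconnected_univ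
    (mem_univ z) hfreq (mem_univ 0)
  exact deBruijnH_apply_zero_ne_zero t h0

/-- The real zeros of `H_t` in `[a, b]` form a finite set. [folklore] -/
theorem finite_real_zeros_deBruijnH_Icc (t a b : ℝ) :
    {x : ℝ | x ∈ Icc a b ∧ deBruijnH t x = 0}.Finite := by
  have hK : IsCompact (((↑) : ℝ → ℂ) '' Icc a b) := isCompact_Icc.image continuous_ofReal
  have hfin := finite_deBruijnH_zeros_of_isCompact t hK
  have hsub : {x : ℝ | x ∈ Icc a b ∧ deBruijnH t x = 0} ⊆
      ((↑) : ℝ → ℂ) ⁻¹' {z : ℂ | z ∈ ((↑) : ℝ → ℂ) '' Icc a b ∧ deBruijnH t z = 0} :=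
    fun x hx ↦ ⟨mem_image_of_mem _ hx.1, hx.2⟩
  exact (hfin.preimage (Complex.ofReal_injective.injOn)).subset hsub

/-- `H_t` on the imaginary axis: `H_t(iy) = ∫₀^∞ e^{tu²} Φ(u) cosh(yu) du`, a real number.
[folklore] -/
theorem deBruijnH_I_mul (t y : ℝ) :
    deBruijnH t (I * y) =
      ((∫ u in Ioi (0 : ℝ), Real.exp (t * u ^ 2) * deBruijnPhi u * Real.cosh (y * u) : ℝ) : ℂ) := by
  rw [deBruijnH, ← integral_complex_ofReal]
  refine setIntegral_congr_fun measurableSet_Ioi fun u _ ↦ ?_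
  have : Complex.cos (I * y * u) = Real.cosh (y * u) := by
    rw [show I * (y : ℂ) * (u : ℂ) = ((y * u : ℝ) : ℂ) * I by push_cast; ring, Complex.cos_mul_I,
      Complex.ofReal_cosh]
  rw [this]
  push_cast
  ring

/-- The integrand `e^{tu²} Φ(u) cosh(yu)` is integrable on `(0, ∞)` (dominated by the tree's
`deBruijnHBound t |y|`). [folklore] -/
theorem integrableOn_exp_mul_phi_mul_cosh (t y : ℝ) :
    IntegrableOn (fun u : ℝ ↦ Real.exp (t * u ^ 2) * deBruijnPhi u * Real.cosh (y * u)) (Ioi 0) := by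
  refine (integrableOn_deBruijnHBound t |y|).mono' ?_
    (ae_restrict_of_forall_mem measurableSet_Ioi fun u hu ↦ ?_)
  · refine ContinuousOn.aestronglyMeasurable ?_ measurableSet_Ioi
    refine ((by fun_prop : Continuous fun u : ℝ ↦ Real.exp (t * u ^ 2)).continuousOn.mul
      (continuousOn_deBruijnPhi_Ici.mono Ioi_subset_Ici_self)).mul ?_
    exact (Real.continuous_cosh.comp (continuous_const.mul continuous_id)).continuousOn
  · have hu0 : 0 ≤ u := le_of_lt hu
    have hΦ : 0 < deBruijnPhi u := deBruijnPhi_pos_of_nonneg hu0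
    rw [deBruijnHBound, Real.norm_eq_abs, abs_mul, abs_mul, abs_of_pos (Real.exp_pos _),
      abs_of_pos hΦ, abs_of_pos (Real.cosh_pos _)]
    refine mul_le_mul_of_nonneg_left ?_ (by positivity)
    have h1 := Real.exp_le_exp.2 (le_abs_self (y * u))
    have h2 := Real.exp_le_exp.2 (neg_le_abs (y * u))
    calc Real.cosh (y * u) ≤ Real.exp |y * u| := by rw [Real.cosh_eq]; linarith
      _ = Real.exp (|y| * u) := by rw [abs_mul, abs_of_nonneg hu0]

/-- Exponential lower bound on the imaginary axis: with `c = ∫₁^∞ e^{tu²} Φ(u) du > 0`,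
`c · cosh y ≤ ∫₀^∞ e^{tu²} Φ(u) cosh(yu) du` for all real `y`. [folklore] -/
theorem exists_pos_mul_cosh_le_integral (t : ℝ) : ∃ c : ℝ, 0 < c ∧ ∀ y : ℝ,
    c * Real.cosh y ≤ ∫ u in Ioi (0 : ℝ), Real.exp (t * u ^ 2) * deBruijnPhi u * Real.cosh (y * u) := by
  set g : ℝ → ℝ := fun u ↦ Real.exp (t * u ^ 2) * deBruijnPhi u with hg
  have hgint : IntegrableOn g (Ioi 1) := by
    have h0 := integrableOn_exp_mul_phi_mul_cosh t 0
    simp only [zero_mul, Real.cosh_zero, mul_one] at h0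
    exact h0.mono_set (Ioi_subset_Ioi zero_le_one)
  have hgpos0 : ∀ u ∈ Ioi (0 : ℝ), 0 < g u := fun u hu ↦
    mul_pos (Real.exp_pos _) (deBruijnPhi_pos_of_nonneg (le_of_lt (mem_Ioi.1 hu)))
  have hgpos : ∀ u ∈ Ioi (1 : ℝ), 0 < g u := fun u hu ↦
    hgpos0 u (Ioi_subset_Ioi zero_le_one hu)
  refine ⟨∫ u in Ioi (1 : ℝ), g u, ?_, fun y ↦ ?_⟩
  · refine (setIntegral_pos_iff_support_of_nonneg_ae
      (ae_restrict_of_forall_mem measurableSet_Ioi fun u hu ↦ (hgpos u hu).le) hgint).2 ?_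
    have : Function.support g ∩ Ioi 1 = Ioi 1 :=
      Set.inter_eq_right.2 fun u hu ↦ (hgpos u hu).ne'
    rw [this, Real.volume_Ioi]
    exact ENNReal.zero_lt_top
  · have hint := integrableOn_exp_mul_phi_mul_cosh t y
    calc (∫ u in Ioi (1 : ℝ), g u) * Real.cosh y
        = ∫ u in Ioi (1 : ℝ), g u * Real.cosh y := by rw [integral_mul_const]
      _ ≤ ∫ u in Ioi (1 : ℝ), g u * Real.cosh (y * u) := by
          refine setIntegral_mono_on (hgint.mul_const _) (hint.mono_set (Ioi_subset_Ioi zero_le_one))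
            measurableSet_Ioi fun u hu ↦ ?_
          refine mul_le_mul_of_nonneg_left (Real.cosh_le_cosh.2 ?_) (hgpos u hu).le
          rw [abs_mul]
          have hu1 : 1 ≤ |u| := le_trans (le_of_lt (mem_Ioi.1 hu)) (le_abs_self u)
          nlinarith [abs_nonneg y]
      _ ≤ ∫ u in Ioi (0 : ℝ), g u * Real.cosh (y * u) :=
          setIntegral_mono_set hint
            (ae_restrict_of_forall_mem measurableSet_Ioi fun u hu ↦
              (mul_pos (hgpos0 u hu) (Real.cosh_pos _)).le)
            (Ioi_subset_Ioi zero_le_one).eventuallyLE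

/-- **`H_t` has infinitely many zeros** (every `t`). If not, only finitely many factors of the
grouped Hadamard product `H_t(z)/H_t(0) = ∏ (1 + b_n z²)` (`exists_isHadamardSeq`) are
non-trivial, so `|H_t(iy)| ≤ M (1 + y²)^N`; but `H_t(iy) = ∫₀^∞ e^{tu²}Φ(u) cosh(yu) du ≥ c cosh y`.
[folklore] -/
theorem infinite_setOf_deBruijnH_eq_zero (t : ℝ) : {z : ℂ | deBruijnH t z = 0}.Infinite := by
  intro hZ
  obtain ⟨b, hb⟩ := exists_isHadamardSeq t
  -- only finitely many `b n` are non-zero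
  have hS : {n : ℕ | b n ≠ 0}.Finite := by
    have hsub : {n : ℕ | b n ≠ 0} ⊆ ⋃ z ∈ {z : ℂ | deBruijnH t z = 0}, {n : ℕ | 1 + b n * z ^ 2 = 0} := by
      intro n hn
      have hn' : b n ≠ 0 := hn
      set ζ : ℂ := (-(b n)⁻¹) ^ ((2 : ℕ)⁻¹ : ℂ) with hζ
      have hζ2 : ζ ^ 2 = -(b n)⁻¹ := Complex.cpow_nat_inv_pow _ two_ne_zero
      have hfac : 1 + b n * ζ ^ 2 = 0 := by rw [hζ2, mul_neg, mul_inv_cancel₀ hn']; ring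
      exact mem_biUnion (hb.eq_zero_of_factor hfac) hfac
    exact (hZ.biUnion fun z _ ↦ hb.finite_setOf_factor_eq_zero z).subset hsub
  set S : Finset ℕ := hS.toFinset with hSdef
  have hprod : ∀ z : ℂ, deBruijnH t z = deBruijnH t 0 * ∏ n ∈ S, (1 + b n * z ^ 2) := by
    intro z
    have h1 : ∏' n, (1 + b n * z ^ 2) = ∏ n ∈ S, (1 + b n * z ^ 2) :=
      tprod_eq_prod fun n hn ↦ by
        have : b n = 0 := by
          by_contra h; exact hn (hS.mem_toFinset.2 h)
        rw [this]; ring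
    rw [← h1, hb.tprod_eq, mul_div_cancel₀ _ (deBruijnH_apply_zero_ne_zero t)]
  -- polynomial upper bound on the imaginary axis
  set M : ℝ := ‖deBruijnH t 0‖ * ∏ n ∈ S, (1 + ‖b n‖) with hM
  set N : ℕ := S.card with hN
  have hupper : ∀ y : ℝ, 0 ≤ y → ‖deBruijnH t (I * y)‖ ≤ M * (1 + y ^ 2) ^ N := by
    intro y hy
    rw [hprod, norm_mul, hM, mul_assoc]
    refine mul_le_mul_of_nonneg_left ?_ (norm_nonneg _)
    rw [hN, ← Finset.prod_const, ← Finset.prod_mul_distrib]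
    refine (Finset.norm_prod_le _ _).trans (Finset.prod_le_prod (fun n _ ↦ norm_nonneg _) fun n _ ↦ ?_)
    calc ‖1 + b n * (I * y) ^ 2‖ ≤ ‖(1 : ℂ)‖ + ‖b n * (I * y) ^ 2‖ := norm_add_le _ _
      _ = 1 + ‖b n‖ * y ^ 2 := by
          rw [norm_one, norm_mul, norm_pow, norm_mul, Complex.norm_I, one_mul, Complex.norm_real,
            Real.norm_eq_abs, abs_of_nonneg hy]
      _ ≤ (1 + ‖b n‖) * (1 + y ^ 2) := by nlinarith [norm_nonneg (b n), sq_nonneg y]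
  -- exponential lower bound
  obtain ⟨c, hc, hlower⟩ := exists_pos_mul_cosh_le_integral t
  have hkey : ∀ y : ℝ, 0 ≤ y → c * Real.cosh y ≤ M * (1 + y ^ 2) ^ N := by
    intro y hy
    refine (hlower y).trans ?_
    have := hupper y hy
    rwa [deBruijnH_I_mul, Complex.norm_real, Real.norm_of_nonneg] at this
    exact le_trans (by positivity) (hlower y)
  -- contradiction: `2 cosh y ≥ y^{2N+1}/(2N+1)!` beats `(1 + y²)^N ≤ (2y²)^N`
  have hM0 : 0 ≤ M := by rw [hM]; positivity
  have hfact : (0 : ℝ) < (2 * N + 1).factorial := by exact_mod_cast Nat.factorial_pos _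
  set K : ℝ := 2 * M * 2 ^ N * (2 * N + 1).factorial / c with hK
  have hK0 : 0 ≤ K := by rw [hK]; positivity
  set Y : ℝ := K + 1 with hY
  have hY0 : 0 ≤ Y := by linarith
  have h1 : Y ^ (2 * N + 1) / (2 * N + 1).factorial ≤ 2 * Real.cosh Y := by
    refine (Real.pow_div_factorial_le_exp Y hY0 _).trans ?_
    rw [Real.cosh_eq]; linarith [Real.exp_pos (-Y)]
  have h2 : (1 + Y ^ 2) ^ N ≤ 2 ^ N * Y ^ (2 * N) := by
    rw [pow_mul, ← mul_pow]
    exact pow_le_pow_left₀ (by positivity) (by nlinarith) N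
  have h3 : c * (Y ^ (2 * N + 1) / (2 * N + 1).factorial) ≤ 2 * M * (2 ^ N * Y ^ (2 * N)) :=
    calc c * (Y ^ (2 * N + 1) / (2 * N + 1).factorial) ≤ c * (2 * Real.cosh Y) :=
          mul_le_mul_of_nonneg_left h1 hc.le
      _ = 2 * (c * Real.cosh Y) := by ring
      _ ≤ 2 * (M * (1 + Y ^ 2) ^ N) := by linarith [hkey Y hY0]
      _ ≤ 2 * (M * (2 ^ N * Y ^ (2 * N))) :=
          mul_le_mul_of_nonneg_left (mul_le_mul_of_nonneg_left h2 hM0) two_pos.le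
      _ = 2 * M * (2 ^ N * Y ^ (2 * N)) := by ring
  have hYpow : 0 < Y ^ (2 * N) := by positivity
  -- `c Y^{2N} Y ≤ 2 M 2^N Y^{2N} (2N+1)!` gives `c Y ≤ 2 M 2^N (2N+1)!`
  have h4 : c * Y ≤ 2 * M * 2 ^ N * (2 * N + 1).factorial := by
    rw [mul_div_assoc', div_le_iff₀ hfact, pow_succ] at h3
    have h3' : Y ^ (2 * N) * (c * Y) ≤ Y ^ (2 * N) * (2 * M * 2 ^ N * (2 * N + 1).factorial) := by
      have e1 : Y ^ (2 * N) * (c * Y) = c * (Y ^ (2 * N) * Y) := by ring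
      have e2 : Y ^ (2 * N) * (2 * M * 2 ^ N * (2 * N + 1).factorial) =
          2 * M * (2 ^ N * Y ^ (2 * N)) * (2 * N + 1).factorial := by ring
      rw [e1, e2]; exact h3
    exact le_of_mul_le_mul_left h3' hYpow
  have h5 : Y ≤ K := by rw [hK, le_div_iff₀ hc]; linarith
  linarith

/-- If all zeros of `H_t` are real, `H_t` has infinitely many *positive real* zeros (`H_t` is even
and `H_t(0) ≠ 0`). [cite: RodgersTaoFMP2020, §1.2] -/
theorem infinite_pos_zeros_deBruijnH {t : ℝ} (hreal : HasOnlyRealZeros (deBruijnH t)) :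
    {x : ℝ | 0 < x ∧ x ∈ {x : ℝ | deBruijnH t x = 0}}.Infinite := by
  intro hfin
  apply infinite_setOf_deBruijnH_eq_zero t
  set P : Set ℝ := {x : ℝ | 0 < x ∧ x ∈ {x : ℝ | deBruijnH t x = 0}} with hP
  have hsub : {z : ℂ | deBruijnH t z = 0} ⊆
      ((↑) : ℝ → ℂ) '' P ∪ (fun x : ℝ ↦ ((-x : ℝ) : ℂ)) '' P := by
    intro z hz
    have hz' : deBruijnH t z = 0 := hz
    have him : z.im = 0 := hreal z hz'
    have hzre : (z.re : ℂ) = z := by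
      apply Complex.ext <;> simp [him]
    have hre0 : z.re ≠ 0 := by
      intro h
      have : z = 0 := by rw [← hzre, h, Complex.ofReal_zero]
      exact deBruijnH_apply_zero_ne_zero t (this ▸ hz')
    rcases lt_or_gt_of_ne hre0 with hneg | hpos
    · right
      refine ⟨-z.re, ⟨by linarith, ?_⟩, by simp [hzre]⟩
      show deBruijnH t ((-z.re : ℝ) : ℂ) = 0
      rw [Complex.ofReal_neg, deBruijnH_neg, hzre]; exact hz'
    · left
      exact ⟨z.re, ⟨hpos, by show deBruijnH t (z.re : ℂ) = 0; rw [hzre]; exact hz'⟩, hzre⟩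
  exact ((hfin.image _).union (hfin.image _)).subset hsub

/-! ## The zeros `x_j(t)` for `t > Λ` -/

/-- `N_t([0, X])` is the `PosEnum.count` of the real zero set of `H_t` (definitional). [folklore] -/
theorem deBruijnZeroCount_Icc_eq_count (t X : ℝ) :
    deBruijnZeroCount t (Icc 0 X) = PosEnum.count {x : ℝ | deBruijnH t x = 0} X := rfl

/-- `x_j(t)` is the `PosEnum.nth` of the real zero set of `H_t` (definitional). [folklore] -/
theorem deBruijnZero_eq_nth (t : ℝ) (j : ℕ) :
    deBruijnZero t j = PosEnum.nth {x : ℝ | deBruijnH t x = 0} j := rfl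

/-- `0` is not a zero of `H_t`. [folklore] -/
theorem zero_notMem_setOf_deBruijnH_eq_zero (t : ℝ) : (0 : ℝ) ∉ {x : ℝ | deBruijnH t x = 0} := by
  simp only [mem_setOf_eq, Complex.ofReal_zero]
  exact deBruijnH_apply_zero_ne_zero t

/-- The real zero set of `H_t` is finite in every `[0, X]`. [folklore] -/
theorem finite_setOf_deBruijnH_eq_zero_Icc (t X : ℝ) :
    {x : ℝ | x ∈ Icc 0 X ∧ x ∈ {x : ℝ | deBruijnH t x = 0}}.Finite :=
  finite_real_zeros_deBruijnH_Icc t 0 X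

/-- Above `Λ` all zeros of `H_t` are real: if `H_{t₁}` has only real zeros for some `t₁ < t`, so
does `H_t` (de Bruijn's monotonicity, `mono_deBruijnH_holds`). [cite: RodgersTaoFMP2020, §1.2] -/
theorem hasOnlyRealZeros_of_exists_lt {t : ℝ}
    (hΛ : ∃ t₁ : ℝ, t₁ < t ∧ HasOnlyRealZeros (deBruijnH t₁)) : HasOnlyRealZeros (deBruijnH t) := by
  obtain ⟨t₁, ht₁, hreal⟩ := hΛ
  exact mono_deBruijnH_holds ht₁.le hreal

/-- **`x_j(t)` is a zero of `H_t`** for `j ≥ 1` and `t > Λ`. [cite: RodgersTaoFMP2020, §1.2] -/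
theorem deBruijnH_deBruijnZero {t : ℝ} (hΛ : ∃ t₁ : ℝ, t₁ < t ∧ HasOnlyRealZeros (deBruijnH t₁))
    {j : ℕ} (hj : 1 ≤ j) : deBruijnH t (deBruijnZero t j) = 0 :=
  PosEnum.nth_mem (finite_setOf_deBruijnH_eq_zero_Icc t)
    (infinite_pos_zeros_deBruijnH (hasOnlyRealZeros_of_exists_lt hΛ)) hj

/-- `0 < x_j(t)` for `j ≥ 1` and `t > Λ`. [cite: RodgersTaoFMP2020, §1.2] -/
theorem deBruijnZero_pos {t : ℝ} (hΛ : ∃ t₁ : ℝ, t₁ < t ∧ HasOnlyRealZeros (deBruijnH t₁))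
    {j : ℕ} (hj : 1 ≤ j) : 0 < deBruijnZero t j :=
  PosEnum.nth_pos (finite_setOf_deBruijnH_eq_zero_Icc t)
    (infinite_pos_zeros_deBruijnH (hasOnlyRealZeros_of_exists_lt hΛ))
    (zero_notMem_setOf_deBruijnH_eq_zero t) hj

/-- **`0 = x_0(t) < x_1(t) < x_2(t) < ⋯`** for `t > Λ`: the zeros are distinct.
[cite: RodgersTaoFMP2020, §1.2] -/
theorem strictMono_deBruijnZero {t : ℝ} (hΛ : ∃ t₁ : ℝ, t₁ < t ∧ HasOnlyRealZeros (deBruijnH t₁)) :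
    StrictMono (deBruijnZero t) :=
  PosEnum.nth_strictMono (finite_setOf_deBruijnH_eq_zero_Icc t)
    (infinite_pos_zeros_deBruijnH (hasOnlyRealZeros_of_exists_lt hΛ))
    (zero_notMem_setOf_deBruijnH_eq_zero t)

/-- `N_t([0, x_j(t)]) = j` for `t > Λ`. [cite: RodgersTaoFMP2020, §3] -/
theorem deBruijnZeroCount_Icc_deBruijnZero {t : ℝ}
    (hΛ : ∃ t₁ : ℝ, t₁ < t ∧ HasOnlyRealZeros (deBruijnH t₁)) (j : ℕ) :
    deBruijnZeroCount t (Icc 0 (deBruijnZero t j)) = j :=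
  PosEnum.count_nth (finite_setOf_deBruijnH_eq_zero_Icc t)
    (infinite_pos_zeros_deBruijnH (hasOnlyRealZeros_of_exists_lt hΛ))
    (zero_notMem_setOf_deBruijnH_eq_zero t) j

/-- `N_t([0, X]) = j` for `x_j(t) ≤ X < x_{j+1}(t)`, `t > Λ`. [cite: RodgersTaoFMP2020, §3] -/
theorem deBruijnZeroCount_Icc_eq {t : ℝ} (hΛ : ∃ t₁ : ℝ, t₁ < t ∧ HasOnlyRealZeros (deBruijnH t₁))
    {j : ℕ} {X : ℝ} (h1 : deBruijnZero t j ≤ X) (h2 : X < deBruijnZero t (j + 1)) :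
    deBruijnZeroCount t (Icc 0 X) = j :=
  PosEnum.count_eq_of_nth_le_of_lt (finite_setOf_deBruijnH_eq_zero_Icc t)
    (infinite_pos_zeros_deBruijnH (hasOnlyRealZeros_of_exists_lt hΛ)) h1 h2

/-- `x_j(t) ≤ X ↔ j ≤ N_t([0, X])` for `X ≥ 0`, `t > Λ`. [cite: RodgersTaoFMP2020, §3] -/
theorem deBruijnZero_le_iff {t : ℝ} (hΛ : ∃ t₁ : ℝ, t₁ < t ∧ HasOnlyRealZeros (deBruijnH t₁))
    {j : ℕ} {X : ℝ} (hX : 0 ≤ X) : deBruijnZero t j ≤ X ↔ j ≤ deBruijnZeroCount t (Icc 0 X) :=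
  PosEnum.nth_le_iff (finite_setOf_deBruijnH_eq_zero_Icc t)
    (infinite_pos_zeros_deBruijnH (hasOnlyRealZeros_of_exists_lt hΛ)) hX

/-- **Every positive zero of `H_t` is an `x_j(t)`** (`t > Λ`), namely `j = N_t([0, x])`.
[cite: RodgersTaoFMP2020, §1.2] -/
theorem exists_deBruijnZero_eq {t : ℝ} (hΛ : ∃ t₁ : ℝ, t₁ < t ∧ HasOnlyRealZeros (deBruijnH t₁))
    {x : ℝ} (hx0 : 0 < x) (hx : deBruijnH t x = 0) : ∃ j : ℕ, 1 ≤ j ∧ deBruijnZero t j = x :=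
  PosEnum.exists_nth_eq (finite_setOf_deBruijnH_eq_zero_Icc t)
    (infinite_pos_zeros_deBruijnH (hasOnlyRealZeros_of_exists_lt hΛ))
    (zero_notMem_setOf_deBruijnH_eq_zero t) hx0 hx

/-- Every real zero of `H_t` (`t > Λ`) is `± x_j(t)` for some `j ≥ 1`. [cite: RodgersTaoFMP2020, §1.2] -/
theorem exists_deBruijnZero_eq_or_eq_neg {t : ℝ}
    (hΛ : ∃ t₁ : ℝ, t₁ < t ∧ HasOnlyRealZeros (deBruijnH t₁)) {x : ℝ} (hx : deBruijnH t x = 0) :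
    ∃ j : ℕ, 1 ≤ j ∧ (deBruijnZero t j = x ∨ deBruijnZero t j = -x) := by
  have hx0 : x ≠ 0 := by
    rintro rfl
    exact deBruijnH_apply_zero_ne_zero t (by simpa using hx)
  rcases lt_or_gt_of_ne hx0 with hneg | hpos
  · obtain ⟨j, hj, hjx⟩ := exists_deBruijnZero_eq hΛ (neg_pos.2 hneg)
      (by rw [Complex.ofReal_neg, deBruijnH_neg]; exact hx)
    exact ⟨j, hj, Or.inr hjx⟩
  · obtain ⟨j, hj, hjx⟩ := exists_deBruijnZero_eq hΛ hpos hx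
    exact ⟨j, hj, Or.inl hjx⟩

/-- Every zero of `H_t` (`t > Λ`) is `± x_j(t)` for some `j ≥ 1`. [cite: RodgersTaoFMP2020, §1.2] -/
theorem exists_deBruijnZero_eq_of_zero {t : ℝ}
    (hΛ : ∃ t₁ : ℝ, t₁ < t ∧ HasOnlyRealZeros (deBruijnH t₁)) {z : ℂ} (hz : deBruijnH t z = 0) :
    ∃ j : ℕ, 1 ≤ j ∧ ((deBruijnZero t j : ℂ) = z ∨ (deBruijnZero t j : ℂ) = -z) := by
  have him : z.im = 0 := hasOnlyRealZeros_of_exists_lt hΛ z hz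
  have hzre : (z.re : ℂ) = z := by apply Complex.ext <;> simp [him]
  obtain ⟨j, hj, h⟩ := exists_deBruijnZero_eq_or_eq_neg hΛ (x := z.re) (by rw [hzre]; exact hz)
  refine ⟨j, hj, ?_⟩
  rcases h with h | h
  · left; rw [h, hzre]
  · right; rw [h, Complex.ofReal_neg, hzre]

/-- **The zeros `x_j(t)` are simple** (`t > Λ`): `H_t'(x_j(t)) ≠ 0` (Csordas–Smith–Varga,
`csordasSmithVarga_simple_zeros_holds`). [cite: RodgersTaoFMP2020, §1.2] -/
theorem deriv_deBruijnH_deBruijnZero_ne_zero {t : ℝ}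
    (hΛ : ∃ t₁ : ℝ, t₁ < t ∧ HasOnlyRealZeros (deBruijnH t₁)) {j : ℕ} (hj : 1 ≤ j) :
    deriv (deBruijnH t) (deBruijnZero t j) ≠ 0 := by
  obtain ⟨t₁, ht₁, hreal⟩ := hΛ
  exact csordasSmithVarga_simple_zeros_holds t₁ t ht₁ hreal _
    (deBruijnH_deBruijnZero ⟨t₁, ht₁, hreal⟩ hj)

/-! ## Non-negativity and monotonicity of the renormalised energy for `t > Λ` -/

/-- The classical locations of distinct natural indices are distinct. [folklore] -/
theorem classicalLocation_natCast_injective : Function.Injective fun n : ℕ ↦ classicalLocation (n : ℝ) := by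
  intro m n h
  have hm : ((m : ℕ) : ℝ) ∈ Ici (-1 : ℝ) := by
    simp only [mem_Ici]; exact le_trans (by norm_num) (Nat.cast_nonneg _)
  have hn : ((n : ℕ) : ℝ) ∈ Ici (-1 : ℝ) := by
    simp only [mem_Ici]; exact le_trans (by norm_num) (Nat.cast_nonneg _)
  exact_mod_cast strictMonoOn_classicalLocation.injOn hm hn h

/-- **`Ẽ_{jk}(t) ≥ 0`** for `j ≠ k` and `t > Λ` (Rodgers–Tao 2020, §7: `V ≥ 0`, and the zeros
`x_j(t)`, `x_k(t)` are distinct). [cite: RodgersTaoFMP2020, §7] -/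
theorem renormEnergy_nonneg_of_lt {t : ℝ} (hΛ : ∃ t₁ : ℝ, t₁ < t ∧ HasOnlyRealZeros (deBruijnH t₁))
    {j k : ℕ} (hjk : j ≠ k) : 0 ≤ renormEnergy t j k := by
  rw [renormEnergy_eq]
  refine div_nonneg (renormPotential_nonneg (div_ne_zero ?_ ?_)) (sq_nonneg _)
  · exact sub_ne_zero.2 fun h ↦ hjk ((strictMono_deBruijnZero hΛ).injective h).symm
  · exact sub_ne_zero.2 fun h ↦ hjk (classicalLocation_natCast_injective h).symm

/-- `Ẽ^I(t) ≥ 0` for `t > Λ`. [cite: RodgersTaoFMP2020, §7] -/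
theorem renormEnergyOn_nonneg_of_lt {t : ℝ} (hΛ : ∃ t₁ : ℝ, t₁ < t ∧ HasOnlyRealZeros (deBruijnH t₁))
    (I : Finset ℕ) : 0 ≤ renormEnergyOn t I := by
  rw [renormEnergyOn_eq]
  exact Finset.sum_nonneg fun p hp ↦ renormEnergy_nonneg_of_lt hΛ (Finset.mem_offDiag.1 hp).2.2

/-- **`Ẽ^I(t)` is monotone in `I`** for `t > Λ` (Rodgers–Tao 2020, §7: "non-decreasing in `I`").
[cite: RodgersTaoFMP2020, §7] -/
theorem renormEnergyOn_mono_of_lt {t : ℝ} (hΛ : ∃ t₁ : ℝ, t₁ < t ∧ HasOnlyRealZeros (deBruijnH t₁))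
    {I J : Finset ℕ} (hIJ : I ⊆ J) : renormEnergyOn t I ≤ renormEnergyOn t J := by
  rw [renormEnergyOn_eq, renormEnergyOn_eq]
  exact Finset.sum_le_sum_of_subset_of_nonneg (Finset.offDiag_mono hIJ) fun p hp _ ↦
    renormEnergy_nonneg_of_lt hΛ (Finset.mem_offDiag.1 hp).2.2

/-- A single term is bounded by the window energy: `Ẽ_{jk}(t) ≤ Ẽ^I(t)` for `j ≠ k ∈ I`, `t > Λ`.
[cite: RodgersTaoFMP2020, §7] -/
theorem renormEnergy_le_renormEnergyOn_of_lt {t : ℝ}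
    (hΛ : ∃ t₁ : ℝ, t₁ < t ∧ HasOnlyRealZeros (deBruijnH t₁)) {I : Finset ℕ} {j k : ℕ}
    (hj : j ∈ I) (hk : k ∈ I) (hjk : j ≠ k) : renormEnergy t j k ≤ renormEnergyOn t I := by
  rw [renormEnergyOn_eq]
  have hmem : (j, k) ∈ I.offDiag := Finset.mem_offDiag.2 ⟨hj, hk, hjk⟩
  have h := Finset.single_le_sum (s := I.offDiag) (f := fun p : ℕ × ℕ ↦ renormEnergy t p.1 p.2)
    (fun p hp ↦ renormEnergy_nonneg_of_lt hΛ (Finset.mem_offDiag.1 hp).2.2) hmem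
  exact h

/-- The Rodgers–Tao setting: under `Λ < 0` witnessed by `t₀ < 0`, every `t > t₀` (in particular
every `t ∈ [t₀/4, 0]`) is above `Λ` in the sense used above. [cite: RodgersTaoFMP2020, §1.2] -/
theorem exists_lt_of_witness {t₀ t : ℝ} (hreal : HasOnlyRealZeros (deBruijnH t₀)) (ht : t₀ < t) :
    ∃ t₁ : ℝ, t₁ < t ∧ HasOnlyRealZeros (deBruijnH t₁) :=
  ⟨t₀, ht, hreal⟩

/-- In particular for `t₀ < 0` and `t₀/4 ≤ t`. [cite: RodgersTaoFMP2020, §1.2] -/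
theorem exists_lt_of_witness_quarter {t₀ t : ℝ} (ht₀ : t₀ < 0) (hreal : HasOnlyRealZeros (deBruijnH t₀))
    (ht : t₀ / 4 ≤ t) : ∃ t₁ : ℝ, t₁ < t ∧ HasOnlyRealZeros (deBruijnH t₁) :=
  ⟨t₀, by linarith, hreal⟩

end Literature.NumberTheory.LFunctions

end
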